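import Summits.BirchSwinnertonDyer.BirchSwinnertonDyer.Theorems.AlignedTransportAtTwoMainConjectureOfRankZeroBSDAtTwoCubicProCyclicDoor
import Summits.BirchSwinnertonDyer.BirchSwinnertonDyer.Theorems.AlignedTransportAtTwoMainConjectureOfRankZeroBSDAtTwoCubicDepthDoorGenusCert
import Literature.NumberTheory.IwasawaTheory.ClassGroupPRankLeOfRelationTwo
import Literature.NumberTheory.IwasawaTheory.ClassGroupPRankLeOfRelationTwoLayer
import Literature.NumberTheory.IwasawaTheory.CyclotomicTwoLayerThreeNonNormUnit
import Literature.NumberTheory.IwasawaTheory.ClassGroupPRankLeOfRelationTwoAnyDepth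
import HarnessLib

/-!
# Route `AlignedTransportAtTwo`, crux C2 `MainConjectureOfRankZeroBSDAtTwo` (stmt-BirchSwinnertonDyer-22298):
# THE RELATION DOOR INTO `μ₂ = 0` AND `MC₂(W)` — on the sub-cell `Δ_min ≡ 5 (mod 8)`, `Δ_W < 0`, `h(ℚ(β))` odd, `2`-adic unit depth `t = 3`:
# ONE relation `∏ σ^i(c)^{f_i} = 1` of order `d ≤ 2` on a class `c ∈ Cl(K_2)` carrying the genus certificate ⟹ `rank₂ Cl(K_m) ≤ d ∀ m`, `μ₂ = 0`, `λ₂ ≤ d`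

HONEST FRAMING (cell `bsd-f1-sign2`, WIDTH-5 attached prover seat `bsd-line-att-p3` gen 48 on line `birth` of the lead `bsd-line-att-p2`;
`--supports` stmt-BirchSwinnertonDyer-22298, closes nothing; BSD is NOT proved by any of this; the crux C2, its verdict «blocked-on
`Rank1Residual.GreenbergMuConjectureIrreducible`» and every registered stub are untouched).  THEOREMS ONLY — no definition, no named fact, no `sorry`.
The `W`-level packaging of this seat's Literature doors `IwasawaTheory/FukudaRelationAlgebra` (the relation lemma over `ℤ[φ]`),
`…/ClassGroupPRankLeOfRelation` (THE RELATION DOOR, every `p`: `p² ∤ #Cl(K_n)^G`, `c ∉ Cl^{σ−1}·Cl^p`, one relation of order `d` ⟹ `rank_p Cl(K_n) ≤ d`; L10)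
and `…/ClassGroupPRankLeOfRelationTwo` (`p = 2`, layer `2`, base-field currency: the `t = 3` unit and the genus certificate), companion of att-p3 g46's
`…CubicProCyclicDoor` (template), g45's `…CubicCapitulationDoor` (the case `f = 1 + X²`) and g47's `…CubicElementaryLayerDoor`.

WHY.  In `Λ`-terms (`X = Λ/J` cyclic as `h(ℚ(β))` is odd and `2 = 𝔭₁𝔭₂`; `A_n = Λ/(J + ν_nΛ)`): the annihilator of a GENERATOR of the cyclic module `A_2` is
`J + ν_2Λ`; a relation `F(σ)c = 0` with `F ≡ T^d·unit (mod 2)`, `d ≤ 2 < 3 = 2² − 1`, shows `J ⊄ 2Λ`, i.e. `μ = 0` (and `λ ≤ d`).  The per-seed certificate is the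
PRINCIPALITY of ONE ideal `∏ σ^i(𝔠)^{f_i}` of the degree-12 field `K_2` (lower-bound type) plus two residues mod `𝔭₁³`/`𝔭₁⁴` in `𝓞_{ℚ(β)}` — no class number,
unit group or non-principality of `K_2`.  Habitat: the whole class `t = 3` of the cell's census (the HARD CORE `e₁ = 1`: 1259, 3027, 3523, 9139, 14891, and the
pro-cyclic class `e₁ ≥ 2`: 12163, 4827); it fires at layer `2` iff `λ ≤ 2` is visible there (census: 3027 with `Cl(K_2)[2^∞] ≅ (ℤ/4)²`).

* **`classicalMuVanishes_adjoin_of_relation_of_genusCert_layer`** (§2) — the same at any layer `K_{j+2}` with the unit hypothesis `ε^{2^j} ∉ N_{K_{j+2}/K}` displayed in the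
  norm currency (this seat's `…/ClassGroupPRankLeOfRelationTwoLayer`).
* **`classicalMuVanishes_adjoin_of_relation_of_genusCert`** — `W` globally minimal, good ordinary at `2`, no rational `2`-torsion abscissa, `Δ_min ≡ 5 (mod 8)`,
  `Δ_W < 0`, `β` a root of the `2`-division cubic; displayed data of `K = ℚ(β)`: `h_K` odd, `2 ∤ d_K`, `𝔭₁` of norm `2`, a unit `ε ≡ ±1 (mod 𝔭₁³)`, `≢ ±1 (mod 𝔭₁⁴)`,
  with `±ε` non-squares; for the cyclotomic `ℤ₂`-extension `κ` of `K` (any compatible algebra structure `K_1 → K_2`): a class `c ∈ Cl(K_2)`, an ideal `𝔄 ≠ 0` of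
  `𝓞_{K_1}` with `N_{K_2/K_1} c = [𝔄]`, `N_{K_1/K}(𝔄)^k = (π)`, `π ≡ ±3 (mod 𝔭₁³)`, a generator `σ` of `Gal(K_2/K)` and ONE relation `∏_{i<N} σ^i(c)^{f_i} = 1` with
  `∑ f_i X^i = (X−1)^d·u + 2g`, `u(1)` odd, `d ≤ 2` ⟹ `rank₂ Cl(K_m) ≤ d ∀ m`, `μ₂(κ) = 0`, `λ₂(κ) ≤ d`.

* **`classicalMuVanishes_adjoin_of_relation_of_genusCert_layer_three`** (§3, att-p3 g49) — layer `K_3` with the unit hypothesis DISCHARGED: `ε ≢ ±1 (mod 𝔭₁⁴)`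
  (`t = 3`) suffices, by the level-`32` dyadic lemma `IwasawaTheory/CyclotomicTwoLayerThreeNonNormUnit` (this seat, g49); relation of order `d ≤ 6` at layer `3`.

* **`classicalMuVanishes_adjoin_of_relation_of_genusCert_layer_anyDepth`** (§4, att-p3 g49) — ANY layer `K_{j+2}`, ANY unit depth `t ≥ 3`: the unit hypothesis is
  GONE (genus cyclicity of the coinvariants + the coinvariant-form relation door, `IwasawaTheory/ClassGroupPRankLeOfRelationTwoAnyDepth`).

CONDITIONAL on displayed data only (no PRINT fact); nothing is asserted about any curve; nothing is closed; BSD is not proved.  The composition with att-p5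
g24's cubic carrier road (`mazurMainConjecture_two_of_muIneqRel_of_classicalMu_cubicField_of_Δ_neg`: PRINT⁵ + MuIneqʳ + `μ₂ = 0` for EVERY cyclotomic `κ`)
is left to the row files, which make the certificate `κ`-free by polynomial identities at every root of `X⁴ − 4X² + 2` (template: att-p3 g45's
`…CubicCapitulationDoor.classicalMuVanishes_adjoin_of_genusCert_odd_of_capitulationCert`).

References: [Washington1997] §13.3 Lemmas 13.15, 13.18, Prop. 13.22–13.23; [Lang1990] Ch. 5 §2, Ch. 13 §4 Lemma 4.1; [Fukuda1994] Thm. 1; [Gras2003] IV.4;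
[Serre1973CourseArithmetic] Ch. III §1.2 Thm. 1; [NeukirchANT1999] Ch. III (1.6), Ch. V §1; tree: this seat's three Literature files above, att-p3 g46
`…CubicProCyclicDoor` (template), att-p3 g43 `…CubicDepthDoorGenusCert` (unit rank one, genus certificate).
-/

set_option linter.dupNamespace false
set_option autoImplicit false

noncomputable section

open scoped Classical NumberField nonZeroDivisors

namespace Summit.BirchSwinnertonDyer.BirchSwinnertonDyer.Theorems.AlignedTransportAtTwoCubicRelationDoor

open NumberField IsDedekindDomain Polynomial WeierstrassCurve IntermediateField CongruenceSubgroup Finset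
  Literature.NumberTheory.IwasawaTheory Literature.NumberTheory.GaloisRepresentations
  Literature.NumberTheory.GaloisRepresentations.Herbrand Literature.NumberTheory.GaloisRepresentations.MinkowskiUnit
  Literature.NumberTheory.GaloisRepresentations.CyclicNormIndex
  Literature.NumberTheory.EllipticCurves Literature.NumberTheory.EllipticCurves.Greenberg1999
  Literature.NumberTheory.EllipticCurves.ModularForms
  Literature.NumberTheory.EllipticCurves.Rank1Residual
  Literature.NumberTheory.EllipticCurves.Module
  Literature.NumberTheory.NumberFields Literature.NumberTheory.NumberFields.AmbiguousClass
  Summit.BirchSwinnertonDyer.Rank1Residual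
  Summit.BirchSwinnertonDyer.Rank1Residual.X1.MuLambda
  Summit.BirchSwinnertonDyer.Rank1Residual.X5
  Summit.BirchSwinnertonDyer.Rank1Residual.F1Sign2
  Summit.BirchSwinnertonDyer.BirchSwinnertonDyer.Theorems.Rank1ResidualX1Defs
  Summit.BirchSwinnertonDyer.BirchSwinnertonDyer.Theses.AlignedTransportAtTwo
  Summit.BirchSwinnertonDyer.BirchSwinnertonDyer.Theorems.AlignedTransportAtTwoKilfordStratumShared
  Summit.BirchSwinnertonDyer.BirchSwinnertonDyer.Theorems.AlignedTransportAtTwoCubicCarrierRoad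
  Summit.BirchSwinnertonDyer.BirchSwinnertonDyer.Theorems.AlignedTransportAtTwoCubicKilfordPrimes
  Summit.BirchSwinnertonDyer.BirchSwinnertonDyer.Theorems.AlignedTransportAtTwoCubicDepthDoorGenusCert
  Summit.BirchSwinnertonDyer.BirchSwinnertonDyer.Theorems.AlignedTransportAtTwoCubicPrimesOfEmbeddings
  Summit.BirchSwinnertonDyer.BirchSwinnertonDyer.Theorems.AlignedTransportAtTwoCubicLayerOneDoors

variable (W : WeierstrassCurve ℚ) [W.IsElliptic] [W.IsGloballyMinimal]

/-! ## §1 `rank₂ ≤ d`, `μ₂ = 0`, `λ₂ ≤ d` for the cubic `2`-torsion field from ONE relation at layer `2` -/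

set_option synthInstance.maxHeartbeats 400000 in
set_option maxHeartbeats 1600000 in
/-- **THE RELATION DOOR FOR THE CUBIC `2`-TORSION FIELD.**  `W/ℚ` globally minimal, good ordinary at `2`, no rational `2`-torsion abscissa, `Δ_min ≡ 5 (mod 8)`
(exactly two primes of `ℚ(β)` above `2`), `Δ_W < 0` (unit rank one), `β ∈ ℚ̄` a root of the `2`-division cubic, `K = ℚ(β)`; displayed: `h_K` odd, `2 ∤ d_K`, an ideal
`𝔭₁` of norm `2`, a unit `ε` with `ε ≡ ±1 (mod 𝔭₁³)`, **`ε ≢ ±1 (mod 𝔭₁⁴)`**, `±ε` non-squares; `κ` a cyclotomic `ℤ₂`-extension of `K` with any compatible algebra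
structure `K_1 → K_2`; a class `c ∈ Cl(K_2)` with the GENUS CERTIFICATE: `𝔄 ≠ 0` an ideal of `𝓞_{K_1}` with `N_{K_2/K_1} c = [𝔄]`, **`N_{K_1/K}(𝔄)^k = (π)`,
`π ≡ ±3 (mod 𝔭₁³)`**; `σ` a generator of `Gal(K_2/K)`; and **ONE RELATION `∏_{i<N} σ^i(c)^{f_i} = 1`** with `∑ f_i X^i = (X−1)^d·u + 2·g` in `ℤ[X]`, `u(1)` odd,
`d ≤ 2`.  THEN `rank₂ Cl(K_m) ≤ d` for every `m`, `μ₂(κ) = 0` and `λ₂(κ) ≤ d`. [cite: Washington1997, §13.3 Prop. 13.22–13.23]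
[cite: Lang1990, Ch. 13 §4, Lemma 4.1 (PDF pp. 203–204)] [cite: Gras2003, IV.4] [cite: Fukuda1994, Thm. 1, p. 264] -/
theorem classicalMuVanishes_adjoin_of_relation_of_genusCert (hord : IsOrdinaryAt W 2)
    (ht : ∀ x : ℚ, ¬ HasRationalTwoTorsionX W x) (h85 : minimalDiscriminantInt W % 8 = 5) (hΔ : W.Δ < 0)
    {β : AlgebraicClosure ℚ} (hβ : aeval β W.twoTorsionPolynomial.toPoly = 0)
    (hh : haveI : FiniteDimensional ℚ ↥(IntermediateField.adjoin ℚ ({β} : Set (AlgebraicClosure ℚ))) :=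
        IntermediateField.adjoin.finiteDimensional ((AlgebraicClosure.isAlgebraic ℚ).isAlgebraic β).isIntegral
      haveI : NumberField ↥(IntermediateField.adjoin ℚ ({β} : Set (AlgebraicClosure ℚ))) := NumberField.mk
      ¬ 2 ∣ classNumber ↥(IntermediateField.adjoin ℚ ({β} : Set (AlgebraicClosure ℚ))))
    (hd : haveI : FiniteDimensional ℚ ↥(IntermediateField.adjoin ℚ ({β} : Set (AlgebraicClosure ℚ))) :=
        IntermediateField.adjoin.finiteDimensional ((AlgebraicClosure.isAlgebraic ℚ).isAlgebraic β).isIntegral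
      haveI : NumberField ↥(IntermediateField.adjoin ℚ ({β} : Set (AlgebraicClosure ℚ))) := NumberField.mk
      ¬ (2 : ℤ) ∣ NumberField.discr ↥(IntermediateField.adjoin ℚ ({β} : Set (AlgebraicClosure ℚ))))
    (𝔭₁ : Ideal (𝓞 ↥(IntermediateField.adjoin ℚ ({β} : Set (AlgebraicClosure ℚ)))))
    (hN : haveI : FiniteDimensional ℚ ↥(IntermediateField.adjoin ℚ ({β} : Set (AlgebraicClosure ℚ))) :=
        IntermediateField.adjoin.finiteDimensional ((AlgebraicClosure.isAlgebraic ℚ).isAlgebraic β).isIntegral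
      haveI : NumberField ↥(IntermediateField.adjoin ℚ ({β} : Set (AlgebraicClosure ℚ))) := NumberField.mk
      Ideal.absNorm 𝔭₁ = 2)
    {ε : (𝓞 ↥(IntermediateField.adjoin ℚ ({β} : Set (AlgebraicClosure ℚ))))ˣ}
    (hε : (ε : 𝓞 ↥(IntermediateField.adjoin ℚ ({β} : Set (AlgebraicClosure ℚ)))) - 1 ∈ 𝔭₁ ^ 3 ∨
      (ε : 𝓞 ↥(IntermediateField.adjoin ℚ ({β} : Set (AlgebraicClosure ℚ)))) + 1 ∈ 𝔭₁ ^ 3)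
    (hε1 : (ε : 𝓞 ↥(IntermediateField.adjoin ℚ ({β} : Set (AlgebraicClosure ℚ)))) - 1 ∉ 𝔭₁ ^ 4)
    (hε2 : (ε : 𝓞 ↥(IntermediateField.adjoin ℚ ({β} : Set (AlgebraicClosure ℚ)))) + 1 ∉ 𝔭₁ ^ 4)
    (hnsq : ∀ z : (𝓞 ↥(IntermediateField.adjoin ℚ ({β} : Set (AlgebraicClosure ℚ))))ˣ, ε ≠ z ^ 2 ∧ ε ≠ -z ^ 2)
    (κP : ZpExtension ↥(IntermediateField.adjoin ℚ ({β} : Set (AlgebraicClosure ℚ))) 2) (hκP : κP.IsCyclotomic)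
    [NumberField (κP.layer 1)] [NumberField (κP.layer 2)] [Algebra (κP.layer 1) (κP.layer 2)]
    [IsScalarTower ↥(IntermediateField.adjoin ℚ ({β} : Set (AlgebraicClosure ℚ))) (κP.layer 1) (κP.layer 2)]
    {π : 𝓞 ↥(IntermediateField.adjoin ℚ ({β} : Set (AlgebraicClosure ℚ)))} (hπ : π - 3 ∈ 𝔭₁ ^ 3 ∨ π + 3 ∈ 𝔭₁ ^ 3)
    {A : Ideal (𝓞 (κP.layer 1))} (hA0 : A ≠ ⊥) {k : ℕ}
    (hA : haveI : FiniteDimensional ℚ ↥(IntermediateField.adjoin ℚ ({β} : Set (AlgebraicClosure ℚ))) :=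
        IntermediateField.adjoin.finiteDimensional ((AlgebraicClosure.isAlgebraic ℚ).isAlgebraic β).isIntegral
      haveI : NumberField ↥(IntermediateField.adjoin ℚ ({β} : Set (AlgebraicClosure ℚ))) := NumberField.mk
      Ideal.relNorm (𝓞 ↥(IntermediateField.adjoin ℚ ({β} : Set (AlgebraicClosure ℚ)))) A ^ k = Ideal.span {π})
    (σ : (κP.layer 2) ≃ₐ[↥(IntermediateField.adjoin ℚ ({β} : Set (AlgebraicClosure ℚ)))] (κP.layer 2))
    (hσ : ∀ τ : (κP.layer 2) ≃ₐ[↥(IntermediateField.adjoin ℚ ({β} : Set (AlgebraicClosure ℚ)))] (κP.layer 2), τ ∈ Subgroup.zpowers σ)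
    {c : ClassGroup (𝓞 (κP.layer 2))}
    (hcA : classGroupNorm (κP.layer 1) (κP.layer 2) c = ClassGroup.mk0 ⟨A, mem_nonZeroDivisors_of_ne_zero hA0⟩)
    {N d : ℕ} (hd2 : d ≤ 2) {f : ℕ → ℤ} {u g : ℤ[X]} (hu : ¬ (2 : ℤ) ∣ u.eval 1)
    (hF : (∑ i ∈ range N, C (f i) * X ^ i : ℤ[X]) = (X - 1) ^ d * u + C (2 : ℤ) * g)
    (hrel : ∏ i ∈ range N, (ClassGroup.mulEquiv (intAut (σ ^ i)) c) ^ (f i) = 1) :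
    (∀ m, classGroupPRank κP m ≤ d) ∧ ClassicalMuVanishes κP ∧ classicalLambda κP ≤ d := by
  have hirr := AlignedTransportAtTwoSeed.irr_two_of_forall_not_hasRationalTwoTorsionX W ht
  have hβint : IsIntegral ℚ β := ((AlgebraicClosure.isAlgebraic ℚ).isAlgebraic β).isIntegral
  haveI : FiniteDimensional ℚ ↥(IntermediateField.adjoin ℚ ({β} : Set (AlgebraicClosure ℚ))) := IntermediateField.adjoin.finiteDimensional hβint
  haveI : NumberField ↥(IntermediateField.adjoin ℚ ({β} : Set (AlgebraicClosure ℚ))) := NumberField.mk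
  haveI : Fact (Nat.Prime 2) := ⟨Nat.prime_two⟩
  have h3 : Module.finrank ℚ ↥(IntermediateField.adjoin ℚ ({β} : Set (AlgebraicClosure ℚ))) = 3 :=
    AddKatoTwo.finrank_adjoin_root_twoTorsionPolynomial_eq_three W hirr hβ
  have hodd3 : ¬ 2 ∣ Module.finrank ℚ ↥(IntermediateField.adjoin ℚ ({β} : Set (AlgebraicClosure ℚ))) := by rw [h3]; decide
  have hoddK : Odd (Module.finrank ℚ ↥(IntermediateField.adjoin ℚ ({β} : Set (AlgebraicClosure ℚ)))) :=
    Nat.odd_iff.mpr (Nat.two_dvd_ne_zero.mp hodd3)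
  -- unit rank `1` (`Δ_W < 0`: one real place)
  have hrank : Units.rank ↥(IntermediateField.adjoin ℚ ({β} : Set (AlgebraicClosure ℚ))) = 1 :=
    units_rank_eq_one_of_nrRealPlaces_eq_one _ h3 (nrRealPlaces_adjoin_root_twoTorsionPolynomial_eq_one W hΔ hirr hβ)
  -- exactly two primes above `2` (`Δ_min ≡ 5 (mod 8)`: off the Kilford stratum)
  have h8 : minimalDiscriminantInt W % 8 ≠ 1 := by rw [h85]; decide
  have hs := (not_onKilfordStratumAtTwo_iff_minimalDiscriminantInt_emod_eight_ne W hord).mpr h8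
  have h2 := ncard_eq_two_of_not_onKilfordStratumAtTwo ↥(IntermediateField.adjoin ℚ ({β} : Set (AlgebraicClosure ℚ))) W hord ht h3
    (AlignedTransportAtTwoCubicKilfordPrimes.aeval_four_mul_gen_twoDivisionUCubic W hβ) hs
  -- the dyadic prime `𝔭₁` of degree one; all units `≡ ±1 (mod 𝔭₁³)`
  obtain ⟨h𝔭₁, hP0, h2P, hcard⟩ := isPrime_and_mem_of_absNorm_eq_two 𝔭₁ hN
  haveI := h𝔭₁
  haveI : 𝔭₁.IsMaximal := h𝔭₁.isMaximal hP0
  have hres := forall_mem_or_sub_one_mem_of_card_quotient_eq_two 𝔭₁ hcard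
  have h2P' : (2 : 𝓞 ↥(IntermediateField.adjoin ℚ ({β} : Set (AlgebraicClosure ℚ)))) ∉ 𝔭₁ ^ 2 := two_not_mem_sq_of_not_dvd_discr hd 𝔭₁ h2P
  have hunits := forall_units_sub_one_mem_or_add_one_mem_of_rank_eq_one hoddK hrank 𝔭₁ hP0 hres h2P h2P' hε hnsq
  exact classicalMuVanishes_two_of_relation_of_genusCert hodd3 hd κP hκP h2 hh 𝔭₁ hres h2P ε hε1 hε2 hunits hπ hA0 hA σ hσ hcA hd2 hu hF hrel

/-! ## §2 The same door at any layer `K_{j+2}` (the hard core's habitat at `j = 1`) -/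

set_option synthInstance.maxHeartbeats 400000 in
set_option maxHeartbeats 1600000 in
/-- **THE RELATION DOOR FOR THE CUBIC `2`-TORSION FIELD AT LAYER `K_{j+2}`.**  As `classicalMuVanishes_adjoin_of_relation_of_genusCert`, with the class `c ∈ Cl(K_{j+2})`,
the genus certificate for `N_{K_{j+2}/K_1}(c)`, `σ` generating `Gal(K_{j+2}/K)`, a relation of order `d` with `d + 2 ≤ 2^{j+2}`, and the unit hypothesis DISPLAYED in the norm
currency: **`ε^{2^j} ∉ N_{K_{j+2}/K} K_{j+2}ˣ`** (`j = 0`: `ε ≢ ±1 (mod 𝔭₁⁴)`; `j = 1`, degree `24`: `σ₁(ε²) ≡ 17 (mod 32)`, the level-`32` dyadic lemma being untyped).  THEN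
`rank₂ Cl(K_m) ≤ d ∀ m`, `μ₂(κ) = 0`, `λ₂(κ) ≤ d`. [cite: Washington1997, §13.3 Prop. 13.22–13.23] [cite: Lang1990, Ch. 13 §4, Lemma 4.1 (PDF pp. 203–204)]
[cite: Gras2003, IV.4] [cite: Fukuda1994, Thm. 1, p. 264] -/
theorem classicalMuVanishes_adjoin_of_relation_of_genusCert_layer (hord : IsOrdinaryAt W 2)
    (ht : ∀ x : ℚ, ¬ HasRationalTwoTorsionX W x) (h85 : minimalDiscriminantInt W % 8 = 5) (hΔ : W.Δ < 0)
    {β : AlgebraicClosure ℚ} (hβ : aeval β W.twoTorsionPolynomial.toPoly = 0)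
    (hh : haveI : FiniteDimensional ℚ ↥(IntermediateField.adjoin ℚ ({β} : Set (AlgebraicClosure ℚ))) :=
        IntermediateField.adjoin.finiteDimensional ((AlgebraicClosure.isAlgebraic ℚ).isAlgebraic β).isIntegral
      haveI : NumberField ↥(IntermediateField.adjoin ℚ ({β} : Set (AlgebraicClosure ℚ))) := NumberField.mk
      ¬ 2 ∣ classNumber ↥(IntermediateField.adjoin ℚ ({β} : Set (AlgebraicClosure ℚ))))
    (hd : haveI : FiniteDimensional ℚ ↥(IntermediateField.adjoin ℚ ({β} : Set (AlgebraicClosure ℚ))) :=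
        IntermediateField.adjoin.finiteDimensional ((AlgebraicClosure.isAlgebraic ℚ).isAlgebraic β).isIntegral
      haveI : NumberField ↥(IntermediateField.adjoin ℚ ({β} : Set (AlgebraicClosure ℚ))) := NumberField.mk
      ¬ (2 : ℤ) ∣ NumberField.discr ↥(IntermediateField.adjoin ℚ ({β} : Set (AlgebraicClosure ℚ))))
    (𝔭₁ : Ideal (𝓞 ↥(IntermediateField.adjoin ℚ ({β} : Set (AlgebraicClosure ℚ)))))
    (hN : haveI : FiniteDimensional ℚ ↥(IntermediateField.adjoin ℚ ({β} : Set (AlgebraicClosure ℚ))) :=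
        IntermediateField.adjoin.finiteDimensional ((AlgebraicClosure.isAlgebraic ℚ).isAlgebraic β).isIntegral
      haveI : NumberField ↥(IntermediateField.adjoin ℚ ({β} : Set (AlgebraicClosure ℚ))) := NumberField.mk
      Ideal.absNorm 𝔭₁ = 2)
    {ε : (𝓞 ↥(IntermediateField.adjoin ℚ ({β} : Set (AlgebraicClosure ℚ))))ˣ}
    (hε : (ε : 𝓞 ↥(IntermediateField.adjoin ℚ ({β} : Set (AlgebraicClosure ℚ)))) - 1 ∈ 𝔭₁ ^ 3 ∨
      (ε : 𝓞 ↥(IntermediateField.adjoin ℚ ({β} : Set (AlgebraicClosure ℚ)))) + 1 ∈ 𝔭₁ ^ 3)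
    (hnsq : ∀ z : (𝓞 ↥(IntermediateField.adjoin ℚ ({β} : Set (AlgebraicClosure ℚ))))ˣ, ε ≠ z ^ 2 ∧ ε ≠ -z ^ 2)
    (κP : ZpExtension ↥(IntermediateField.adjoin ℚ ({β} : Set (AlgebraicClosure ℚ))) 2) (hκP : κP.IsCyclotomic) (j : ℕ)
    [NumberField (κP.layer 1)] [NumberField (κP.layer (j + 2))] [Algebra (κP.layer 1) (κP.layer (j + 2))]
    [IsScalarTower ↥(IntermediateField.adjoin ℚ ({β} : Set (AlgebraicClosure ℚ))) (κP.layer 1) (κP.layer (j + 2))]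
    (hnot : haveI : FiniteDimensional ℚ ↥(IntermediateField.adjoin ℚ ({β} : Set (AlgebraicClosure ℚ))) :=
        IntermediateField.adjoin.finiteDimensional ((AlgebraicClosure.isAlgebraic ℚ).isAlgebraic β).isIntegral
      haveI : NumberField ↥(IntermediateField.adjoin ℚ ({β} : Set (AlgebraicClosure ℚ))) := NumberField.mk
      (unitsIncl ↥(IntermediateField.adjoin ℚ ({β} : Set (AlgebraicClosure ℚ))) (κP.layer (j + 2))
        (Units.map (algebraMap (𝓞 ↥(IntermediateField.adjoin ℚ ({β} : Set (AlgebraicClosure ℚ))))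
          ↥(IntermediateField.adjoin ℚ ({β} : Set (AlgebraicClosure ℚ))) :
          𝓞 ↥(IntermediateField.adjoin ℚ ({β} : Set (AlgebraicClosure ℚ))) →* ↥(IntermediateField.adjoin ℚ ({β} : Set (AlgebraicClosure ℚ)))) ε)) ^ 2 ^ j ∉
      (⊤ : Subgroup (κP.layer (j + 2))ˣ).map (Herbrand.norm ((κP.layer (j + 2)) ≃ₐ[↥(IntermediateField.adjoin ℚ ({β} : Set (AlgebraicClosure ℚ)))] (κP.layer (j + 2)))))
    {π : 𝓞 ↥(IntermediateField.adjoin ℚ ({β} : Set (AlgebraicClosure ℚ)))} (hπ : π - 3 ∈ 𝔭₁ ^ 3 ∨ π + 3 ∈ 𝔭₁ ^ 3)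
    {A : Ideal (𝓞 (κP.layer 1))} (hA0 : A ≠ ⊥) {k : ℕ}
    (hA : haveI : FiniteDimensional ℚ ↥(IntermediateField.adjoin ℚ ({β} : Set (AlgebraicClosure ℚ))) :=
        IntermediateField.adjoin.finiteDimensional ((AlgebraicClosure.isAlgebraic ℚ).isAlgebraic β).isIntegral
      haveI : NumberField ↥(IntermediateField.adjoin ℚ ({β} : Set (AlgebraicClosure ℚ))) := NumberField.mk
      Ideal.relNorm (𝓞 ↥(IntermediateField.adjoin ℚ ({β} : Set (AlgebraicClosure ℚ)))) A ^ k = Ideal.span {π})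
    (σ : (κP.layer (j + 2)) ≃ₐ[↥(IntermediateField.adjoin ℚ ({β} : Set (AlgebraicClosure ℚ)))] (κP.layer (j + 2)))
    (hσ : ∀ τ : (κP.layer (j + 2)) ≃ₐ[↥(IntermediateField.adjoin ℚ ({β} : Set (AlgebraicClosure ℚ)))] (κP.layer (j + 2)), τ ∈ Subgroup.zpowers σ)
    {c : ClassGroup (𝓞 (κP.layer (j + 2)))}
    (hcA : classGroupNorm (κP.layer 1) (κP.layer (j + 2)) c = ClassGroup.mk0 ⟨A, mem_nonZeroDivisors_of_ne_zero hA0⟩)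
    {N d : ℕ} (hd2 : d + 2 ≤ 2 ^ (j + 2)) {f : ℕ → ℤ} {u g : ℤ[X]} (hu : ¬ (2 : ℤ) ∣ u.eval 1)
    (hF : (∑ i ∈ range N, C (f i) * X ^ i : ℤ[X]) = (X - 1) ^ d * u + C (2 : ℤ) * g)
    (hrel : ∏ i ∈ range N, (ClassGroup.mulEquiv (intAut (σ ^ i)) c) ^ (f i) = 1) :
    (∀ m, classGroupPRank κP m ≤ d) ∧ ClassicalMuVanishes κP ∧ classicalLambda κP ≤ d := by
  have hirr := AlignedTransportAtTwoSeed.irr_two_of_forall_not_hasRationalTwoTorsionX W ht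
  have hβint : IsIntegral ℚ β := ((AlgebraicClosure.isAlgebraic ℚ).isAlgebraic β).isIntegral
  haveI : FiniteDimensional ℚ ↥(IntermediateField.adjoin ℚ ({β} : Set (AlgebraicClosure ℚ))) := IntermediateField.adjoin.finiteDimensional hβint
  haveI : NumberField ↥(IntermediateField.adjoin ℚ ({β} : Set (AlgebraicClosure ℚ))) := NumberField.mk
  haveI : Fact (Nat.Prime 2) := ⟨Nat.prime_two⟩
  have h3 : Module.finrank ℚ ↥(IntermediateField.adjoin ℚ ({β} : Set (AlgebraicClosure ℚ))) = 3 :=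
    AddKatoTwo.finrank_adjoin_root_twoTorsionPolynomial_eq_three W hirr hβ
  have hodd3 : ¬ 2 ∣ Module.finrank ℚ ↥(IntermediateField.adjoin ℚ ({β} : Set (AlgebraicClosure ℚ))) := by rw [h3]; decide
  have hoddK : Odd (Module.finrank ℚ ↥(IntermediateField.adjoin ℚ ({β} : Set (AlgebraicClosure ℚ)))) :=
    Nat.odd_iff.mpr (Nat.two_dvd_ne_zero.mp hodd3)
  have hrank : Units.rank ↥(IntermediateField.adjoin ℚ ({β} : Set (AlgebraicClosure ℚ))) = 1 :=
    units_rank_eq_one_of_nrRealPlaces_eq_one _ h3 (nrRealPlaces_adjoin_root_twoTorsionPolynomial_eq_one W hΔ hirr hβ)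
  have h8 : minimalDiscriminantInt W % 8 ≠ 1 := by rw [h85]; decide
  have hs := (not_onKilfordStratumAtTwo_iff_minimalDiscriminantInt_emod_eight_ne W hord).mpr h8
  have h2 := ncard_eq_two_of_not_onKilfordStratumAtTwo ↥(IntermediateField.adjoin ℚ ({β} : Set (AlgebraicClosure ℚ))) W hord ht h3
    (AlignedTransportAtTwoCubicKilfordPrimes.aeval_four_mul_gen_twoDivisionUCubic W hβ) hs
  obtain ⟨h𝔭₁, hP0, h2P, hcard⟩ := isPrime_and_mem_of_absNorm_eq_two 𝔭₁ hN
  haveI := h𝔭₁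
  haveI : 𝔭₁.IsMaximal := h𝔭₁.isMaximal hP0
  have hres := forall_mem_or_sub_one_mem_of_card_quotient_eq_two 𝔭₁ hcard
  have h2P' : (2 : 𝓞 ↥(IntermediateField.adjoin ℚ ({β} : Set (AlgebraicClosure ℚ)))) ∉ 𝔭₁ ^ 2 := two_not_mem_sq_of_not_dvd_discr hd 𝔭₁ h2P
  have hunits := forall_units_sub_one_mem_or_add_one_mem_of_rank_eq_one hoddK hrank 𝔭₁ hP0 hres h2P h2P' hε hnsq
  exact classicalMuVanishes_two_of_relation_of_genusCert_layer hodd3 hd κP hκP h2 hh j 𝔭₁ hres h2P hunits ε hnot hπ hA0 hA σ hσ hcA hd2 hu hF hrel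

/-! ## §3 Layer `K_3` (the hard core's habitat) with the unit hypothesis DISCHARGED: `t = 3` suffices (att-p3 g49's level-`32` dyadic lemma) -/

set_option synthInstance.maxHeartbeats 400000 in
set_option maxHeartbeats 1600000 in
/-- **THE RELATION DOOR FOR THE CUBIC `2`-TORSION FIELD AT LAYER `K_3`, FROM BASE-FIELD CONGRUENCES ONLY** (att-p3 g49).  As
`classicalMuVanishes_adjoin_of_relation_of_genusCert_layer` at `j = 1` (degree `24`), but the unit hypothesis `ε² ∉ N_{K_3/K} K_3ˣ` is no longer displayed: it is
DISCHARGED by the level-`32` dyadic lemma (`IwasawaTheory.unitsIncl_unitsMap_pow_two_not_mem_map_norm_layer_three`: `ε ≡ ±1 (mod 𝔭₁³)`, **`ε ≢ ±1 (mod 𝔭₁⁴)`** ⟹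
`σ₁(ε²) ≡ 17 (mod 32)` ⟹ `ε² ∉ N_{K_3/K}`).  `W/ℚ` globally minimal, good ordinary at `2`, no rational `2`-torsion abscissa, `Δ_min ≡ 5 (mod 8)`, `Δ_W < 0`, `β` a root
of the `2`-division cubic, `K = ℚ(β)`; displayed: `h_K` odd, `2 ∤ d_K`, `𝔭₁` of norm `2`, a unit `ε ≡ ±1 (mod 𝔭₁³)`, `≢ ±1 (mod 𝔭₁⁴)` with `±ε` non-squares (`t = 3`);
`κ` cyclotomic with any compatible algebra structure `K_1 → K_3`; a class `c ∈ Cl(K_3)` with the genus certificate `(𝔄, k, π)` for `N_{K_3/K_1}(c)`; `σ` generating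
`Gal(K_3/K)`; ONE relation `∏_{i<N} σ^i(c)^{f_i} = 1` with `∑ f_i X^i = (X−1)^d·u + 2g`, `u(1)` odd, **`d ≤ 6`**.  THEN `rank₂ Cl(K_m) ≤ d ∀ m`, `μ₂(κ) = 0`, `λ₂(κ) ≤ d`.
(Cell reading: the HARD CORE `t = 3 ∧ e₁ = 1` — `N = 1259, 3523, 14891` — is silent at layer `2` (`Cl(K_2) = (ℤ/2)³`); its certificate is ONE principal generator
in the degree-`24` field `K_3` plus residues in `𝓞_{ℚ(β)}`, nothing else.) [cite: Washington1997, §13.3 Prop. 13.22–13.23] [cite: Lang1990, Ch. 13 §4, Lemma 4.1 (PDF pp. 203–204)]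
[cite: Gras2003, IV.4] [cite: Fukuda1994, Thm. 1, p. 264] [cite: NeukirchANT1999, Ch. V §1 (norm group of `ℚ₂(ζ₃₂)`)] -/
theorem classicalMuVanishes_adjoin_of_relation_of_genusCert_layer_three (hord : IsOrdinaryAt W 2)
    (ht : ∀ x : ℚ, ¬ HasRationalTwoTorsionX W x) (h85 : minimalDiscriminantInt W % 8 = 5) (hΔ : W.Δ < 0)
    {β : AlgebraicClosure ℚ} (hβ : aeval β W.twoTorsionPolynomial.toPoly = 0)
    (hh : haveI : FiniteDimensional ℚ ↥(IntermediateField.adjoin ℚ ({β} : Set (AlgebraicClosure ℚ))) :=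
        IntermediateField.adjoin.finiteDimensional ((AlgebraicClosure.isAlgebraic ℚ).isAlgebraic β).isIntegral
      haveI : NumberField ↥(IntermediateField.adjoin ℚ ({β} : Set (AlgebraicClosure ℚ))) := NumberField.mk
      ¬ 2 ∣ classNumber ↥(IntermediateField.adjoin ℚ ({β} : Set (AlgebraicClosure ℚ))))
    (hd : haveI : FiniteDimensional ℚ ↥(IntermediateField.adjoin ℚ ({β} : Set (AlgebraicClosure ℚ))) :=
        IntermediateField.adjoin.finiteDimensional ((AlgebraicClosure.isAlgebraic ℚ).isAlgebraic β).isIntegral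
      haveI : NumberField ↥(IntermediateField.adjoin ℚ ({β} : Set (AlgebraicClosure ℚ))) := NumberField.mk
      ¬ (2 : ℤ) ∣ NumberField.discr ↥(IntermediateField.adjoin ℚ ({β} : Set (AlgebraicClosure ℚ))))
    (𝔭₁ : Ideal (𝓞 ↥(IntermediateField.adjoin ℚ ({β} : Set (AlgebraicClosure ℚ)))))
    (hN : haveI : FiniteDimensional ℚ ↥(IntermediateField.adjoin ℚ ({β} : Set (AlgebraicClosure ℚ))) :=
        IntermediateField.adjoin.finiteDimensional ((AlgebraicClosure.isAlgebraic ℚ).isAlgebraic β).isIntegral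
      haveI : NumberField ↥(IntermediateField.adjoin ℚ ({β} : Set (AlgebraicClosure ℚ))) := NumberField.mk
      Ideal.absNorm 𝔭₁ = 2)
    {ε : (𝓞 ↥(IntermediateField.adjoin ℚ ({β} : Set (AlgebraicClosure ℚ))))ˣ}
    (hε : (ε : 𝓞 ↥(IntermediateField.adjoin ℚ ({β} : Set (AlgebraicClosure ℚ)))) - 1 ∈ 𝔭₁ ^ 3 ∨
      (ε : 𝓞 ↥(IntermediateField.adjoin ℚ ({β} : Set (AlgebraicClosure ℚ)))) + 1 ∈ 𝔭₁ ^ 3)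
    (hε1 : (ε : 𝓞 ↥(IntermediateField.adjoin ℚ ({β} : Set (AlgebraicClosure ℚ)))) - 1 ∉ 𝔭₁ ^ 4)
    (hε2 : (ε : 𝓞 ↥(IntermediateField.adjoin ℚ ({β} : Set (AlgebraicClosure ℚ)))) + 1 ∉ 𝔭₁ ^ 4)
    (hnsq : ∀ z : (𝓞 ↥(IntermediateField.adjoin ℚ ({β} : Set (AlgebraicClosure ℚ))))ˣ, ε ≠ z ^ 2 ∧ ε ≠ -z ^ 2)
    (κP : ZpExtension ↥(IntermediateField.adjoin ℚ ({β} : Set (AlgebraicClosure ℚ))) 2) (hκP : κP.IsCyclotomic)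
    [NumberField (κP.layer 1)] [NumberField (κP.layer 3)] [Algebra (κP.layer 1) (κP.layer 3)]
    [IsScalarTower ↥(IntermediateField.adjoin ℚ ({β} : Set (AlgebraicClosure ℚ))) (κP.layer 1) (κP.layer 3)]
    {π : 𝓞 ↥(IntermediateField.adjoin ℚ ({β} : Set (AlgebraicClosure ℚ)))} (hπ : π - 3 ∈ 𝔭₁ ^ 3 ∨ π + 3 ∈ 𝔭₁ ^ 3)
    {A : Ideal (𝓞 (κP.layer 1))} (hA0 : A ≠ ⊥) {k : ℕ}
    (hA : haveI : FiniteDimensional ℚ ↥(IntermediateField.adjoin ℚ ({β} : Set (AlgebraicClosure ℚ))) :=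
        IntermediateField.adjoin.finiteDimensional ((AlgebraicClosure.isAlgebraic ℚ).isAlgebraic β).isIntegral
      haveI : NumberField ↥(IntermediateField.adjoin ℚ ({β} : Set (AlgebraicClosure ℚ))) := NumberField.mk
      Ideal.relNorm (𝓞 ↥(IntermediateField.adjoin ℚ ({β} : Set (AlgebraicClosure ℚ)))) A ^ k = Ideal.span {π})
    (σ : (κP.layer 3) ≃ₐ[↥(IntermediateField.adjoin ℚ ({β} : Set (AlgebraicClosure ℚ)))] (κP.layer 3))
    (hσ : ∀ τ : (κP.layer 3) ≃ₐ[↥(IntermediateField.adjoin ℚ ({β} : Set (AlgebraicClosure ℚ)))] (κP.layer 3), τ ∈ Subgroup.zpowers σ)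
    {c : ClassGroup (𝓞 (κP.layer 3))}
    (hcA : classGroupNorm (κP.layer 1) (κP.layer 3) c = ClassGroup.mk0 ⟨A, mem_nonZeroDivisors_of_ne_zero hA0⟩)
    {N d : ℕ} (hd6 : d ≤ 6) {f : ℕ → ℤ} {u g : ℤ[X]} (hu : ¬ (2 : ℤ) ∣ u.eval 1)
    (hF : (∑ i ∈ range N, C (f i) * X ^ i : ℤ[X]) = (X - 1) ^ d * u + C (2 : ℤ) * g)
    (hrel : ∏ i ∈ range N, (ClassGroup.mulEquiv (intAut (σ ^ i)) c) ^ (f i) = 1) :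
    (∀ m, classGroupPRank κP m ≤ d) ∧ ClassicalMuVanishes κP ∧ classicalLambda κP ≤ d := by
  have hirr := AlignedTransportAtTwoSeed.irr_two_of_forall_not_hasRationalTwoTorsionX W ht
  have hβint : IsIntegral ℚ β := ((AlgebraicClosure.isAlgebraic ℚ).isAlgebraic β).isIntegral
  haveI : FiniteDimensional ℚ ↥(IntermediateField.adjoin ℚ ({β} : Set (AlgebraicClosure ℚ))) := IntermediateField.adjoin.finiteDimensional hβint
  haveI : NumberField ↥(IntermediateField.adjoin ℚ ({β} : Set (AlgebraicClosure ℚ))) := NumberField.mk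
  haveI : Fact (Nat.Prime 2) := ⟨Nat.prime_two⟩
  have h3 : Module.finrank ℚ ↥(IntermediateField.adjoin ℚ ({β} : Set (AlgebraicClosure ℚ))) = 3 :=
    AddKatoTwo.finrank_adjoin_root_twoTorsionPolynomial_eq_three W hirr hβ
  have hodd3 : ¬ 2 ∣ Module.finrank ℚ ↥(IntermediateField.adjoin ℚ ({β} : Set (AlgebraicClosure ℚ))) := by rw [h3]; decide
  have hoddK : Odd (Module.finrank ℚ ↥(IntermediateField.adjoin ℚ ({β} : Set (AlgebraicClosure ℚ)))) :=
    Nat.odd_iff.mpr (Nat.two_dvd_ne_zero.mp hodd3)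
  have hrank : Units.rank ↥(IntermediateField.adjoin ℚ ({β} : Set (AlgebraicClosure ℚ))) = 1 :=
    units_rank_eq_one_of_nrRealPlaces_eq_one _ h3 (nrRealPlaces_adjoin_root_twoTorsionPolynomial_eq_one W hΔ hirr hβ)
  have h8 : minimalDiscriminantInt W % 8 ≠ 1 := by rw [h85]; decide
  have hs := (not_onKilfordStratumAtTwo_iff_minimalDiscriminantInt_emod_eight_ne W hord).mpr h8
  have h2 := ncard_eq_two_of_not_onKilfordStratumAtTwo ↥(IntermediateField.adjoin ℚ ({β} : Set (AlgebraicClosure ℚ))) W hord ht h3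
    (AlignedTransportAtTwoCubicKilfordPrimes.aeval_four_mul_gen_twoDivisionUCubic W hβ) hs
  obtain ⟨h𝔭₁, hP0, h2P, hcard⟩ := isPrime_and_mem_of_absNorm_eq_two 𝔭₁ hN
  haveI := h𝔭₁
  haveI : 𝔭₁.IsMaximal := h𝔭₁.isMaximal hP0
  have hres := forall_mem_or_sub_one_mem_of_card_quotient_eq_two 𝔭₁ hcard
  have h2P' : (2 : 𝓞 ↥(IntermediateField.adjoin ℚ ({β} : Set (AlgebraicClosure ℚ)))) ∉ 𝔭₁ ^ 2 := two_not_mem_sq_of_not_dvd_discr hd 𝔭₁ h2P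
  have hunits := forall_units_sub_one_mem_or_add_one_mem_of_rank_eq_one hoddK hrank 𝔭₁ hP0 hres h2P h2P' hε hnsq
  exact classicalMuVanishes_two_of_relation_of_genusCert_layer_three hodd3 hd κP hκP h2 hh 𝔭₁ hres h2P hunits ε hε1 hε2 hπ hA0 hA σ hσ hcA hd6 hu hF hrel

/-! ## §4 ANY layer `K_{j+2}`, ANY unit depth `t ≥ 3`: the unit hypothesis is GONE (att-p3 g49's genus cyclicity + coinvariant-form relation door) -/

set_option synthInstance.maxHeartbeats 400000 in
set_option maxHeartbeats 1600000 in
/-- **THE RELATION DOOR FOR THE CUBIC `2`-TORSION FIELD AT ANY LAYER, ANY UNIT DEPTH** (att-p3 g49).  As `classicalMuVanishes_adjoin_of_relation_of_genusCert_layer`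
(§2) but WITHOUT the displayed unit hypothesis `ε^{2^j} ∉ N_{K_{j+2}/K} K_{j+2}ˣ` and without `ε ≢ ±1 (mod 𝔭₁⁴)`: over `K = ℚ(β)` (`Δ_min ≡ 5 (8)`, `Δ_W < 0`, `h_K` odd,
`2 ∤ d_K`) the `Gal(K_n/K)`-coinvariants of `Cl(K_n)/2` are cyclic for EVERY unit depth (`IwasawaTheory.classicalMuVanishes_two_of_relation_of_genusCert_layer_anyDepth`:
genus theory through the Hilbert class field + the equivariant Artin isomorphism).  Displayed data: `h_K` odd, `2 ∤ d_K`, `𝔭₁` of norm `2`, a unit `ε ≡ ±1 (mod 𝔭₁³)` with `±ε`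
non-squares (so every unit is `≡ ±1 (mod 𝔭₁³)`, i.e. `t ≥ 3`); `κ` cyclotomic; a class `c ∈ Cl(K_{j+2})` with the genus certificate `(𝔄, k, π)` for `N_{K_{j+2}/K_1}(c)`;
`σ` generating `Gal(K_{j+2}/K)`; ONE relation `∏_{i<N} σ^i(c)^{f_i} = 1` with `∑ f_i X^i = (X−1)^d·u + 2g`, `u(1)` odd, `d + 2 ≤ 2^{j+2}`.  THEN `rank₂ Cl(K_m) ≤ d ∀ m`,
`μ₂(κ) = 0`, `λ₂(κ) ≤ d`.  HABITAT: the whole class `t ≥ 3` of the cell's census — the hard core (`t = 3 ∧ e₁ = 1`: 1259, 3027, 3523, 9139, 14891) AND the converse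
quadrant (`t ≥ 4 ∧ e₁ ≥ 2`: 1187, 4307, 13971, 14539), on which no door fired before. [cite: Washington1997, §13.3 Prop. 13.22–13.23]
[cite: Lang1990, Ch. 13 §4, Lemma 4.1 (PDF pp. 203–204)] [cite: Gras2003, IV.4] [cite: Fukuda1994, Thm. 1, p. 264] -/
theorem classicalMuVanishes_adjoin_of_relation_of_genusCert_layer_anyDepth (hord : IsOrdinaryAt W 2)
    (ht : ∀ x : ℚ, ¬ HasRationalTwoTorsionX W x) (h85 : minimalDiscriminantInt W % 8 = 5) (hΔ : W.Δ < 0)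
    {β : AlgebraicClosure ℚ} (hβ : aeval β W.twoTorsionPolynomial.toPoly = 0)
    (hh : haveI : FiniteDimensional ℚ ↥(IntermediateField.adjoin ℚ ({β} : Set (AlgebraicClosure ℚ))) :=
        IntermediateField.adjoin.finiteDimensional ((AlgebraicClosure.isAlgebraic ℚ).isAlgebraic β).isIntegral
      haveI : NumberField ↥(IntermediateField.adjoin ℚ ({β} : Set (AlgebraicClosure ℚ))) := NumberField.mk
      ¬ 2 ∣ classNumber ↥(IntermediateField.adjoin ℚ ({β} : Set (AlgebraicClosure ℚ))))
    (hd : haveI : FiniteDimensional ℚ ↥(IntermediateField.adjoin ℚ ({β} : Set (AlgebraicClosure ℚ))) :=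
        IntermediateField.adjoin.finiteDimensional ((AlgebraicClosure.isAlgebraic ℚ).isAlgebraic β).isIntegral
      haveI : NumberField ↥(IntermediateField.adjoin ℚ ({β} : Set (AlgebraicClosure ℚ))) := NumberField.mk
      ¬ (2 : ℤ) ∣ NumberField.discr ↥(IntermediateField.adjoin ℚ ({β} : Set (AlgebraicClosure ℚ))))
    (𝔭₁ : Ideal (𝓞 ↥(IntermediateField.adjoin ℚ ({β} : Set (AlgebraicClosure ℚ)))))
    (hN : haveI : FiniteDimensional ℚ ↥(IntermediateField.adjoin ℚ ({β} : Set (AlgebraicClosure ℚ))) :=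
        IntermediateField.adjoin.finiteDimensional ((AlgebraicClosure.isAlgebraic ℚ).isAlgebraic β).isIntegral
      haveI : NumberField ↥(IntermediateField.adjoin ℚ ({β} : Set (AlgebraicClosure ℚ))) := NumberField.mk
      Ideal.absNorm 𝔭₁ = 2)
    {ε : (𝓞 ↥(IntermediateField.adjoin ℚ ({β} : Set (AlgebraicClosure ℚ))))ˣ}
    (hε : (ε : 𝓞 ↥(IntermediateField.adjoin ℚ ({β} : Set (AlgebraicClosure ℚ)))) - 1 ∈ 𝔭₁ ^ 3 ∨
      (ε : 𝓞 ↥(IntermediateField.adjoin ℚ ({β} : Set (AlgebraicClosure ℚ)))) + 1 ∈ 𝔭₁ ^ 3)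
    (hnsq : ∀ z : (𝓞 ↥(IntermediateField.adjoin ℚ ({β} : Set (AlgebraicClosure ℚ))))ˣ, ε ≠ z ^ 2 ∧ ε ≠ -z ^ 2)
    (κP : ZpExtension ↥(IntermediateField.adjoin ℚ ({β} : Set (AlgebraicClosure ℚ))) 2) (hκP : κP.IsCyclotomic) (j : ℕ)
    [NumberField (κP.layer 1)] [NumberField (κP.layer (j + 2))] [Algebra (κP.layer 1) (κP.layer (j + 2))]
    [IsScalarTower ↥(IntermediateField.adjoin ℚ ({β} : Set (AlgebraicClosure ℚ))) (κP.layer 1) (κP.layer (j + 2))]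
    {π : 𝓞 ↥(IntermediateField.adjoin ℚ ({β} : Set (AlgebraicClosure ℚ)))} (hπ : π - 3 ∈ 𝔭₁ ^ 3 ∨ π + 3 ∈ 𝔭₁ ^ 3)
    {A : Ideal (𝓞 (κP.layer 1))} (hA0 : A ≠ ⊥) {k : ℕ}
    (hA : haveI : FiniteDimensional ℚ ↥(IntermediateField.adjoin ℚ ({β} : Set (AlgebraicClosure ℚ))) :=
        IntermediateField.adjoin.finiteDimensional ((AlgebraicClosure.isAlgebraic ℚ).isAlgebraic β).isIntegral
      haveI : NumberField ↥(IntermediateField.adjoin ℚ ({β} : Set (AlgebraicClosure ℚ))) := NumberField.mk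
      Ideal.relNorm (𝓞 ↥(IntermediateField.adjoin ℚ ({β} : Set (AlgebraicClosure ℚ)))) A ^ k = Ideal.span {π})
    (σ : (κP.layer (j + 2)) ≃ₐ[↥(IntermediateField.adjoin ℚ ({β} : Set (AlgebraicClosure ℚ)))] (κP.layer (j + 2)))
    (hσ : ∀ τ : (κP.layer (j + 2)) ≃ₐ[↥(IntermediateField.adjoin ℚ ({β} : Set (AlgebraicClosure ℚ)))] (κP.layer (j + 2)), τ ∈ Subgroup.zpowers σ)
    {c : ClassGroup (𝓞 (κP.layer (j + 2)))}
    (hcA : classGroupNorm (κP.layer 1) (κP.layer (j + 2)) c = ClassGroup.mk0 ⟨A, mem_nonZeroDivisors_of_ne_zero hA0⟩)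
    {N d : ℕ} (hd2 : d + 2 ≤ 2 ^ (j + 2)) {f : ℕ → ℤ} {u g : ℤ[X]} (hu : ¬ (2 : ℤ) ∣ u.eval 1)
    (hF : (∑ i ∈ range N, C (f i) * X ^ i : ℤ[X]) = (X - 1) ^ d * u + C (2 : ℤ) * g)
    (hrel : ∏ i ∈ range N, (ClassGroup.mulEquiv (intAut (σ ^ i)) c) ^ (f i) = 1) :
    (∀ m, classGroupPRank κP m ≤ d) ∧ ClassicalMuVanishes κP ∧ classicalLambda κP ≤ d := by
  have hirr := AlignedTransportAtTwoSeed.irr_two_of_forall_not_hasRationalTwoTorsionX W ht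
  have hβint : IsIntegral ℚ β := ((AlgebraicClosure.isAlgebraic ℚ).isAlgebraic β).isIntegral
  haveI : FiniteDimensional ℚ ↥(IntermediateField.adjoin ℚ ({β} : Set (AlgebraicClosure ℚ))) := IntermediateField.adjoin.finiteDimensional hβint
  haveI : NumberField ↥(IntermediateField.adjoin ℚ ({β} : Set (AlgebraicClosure ℚ))) := NumberField.mk
  haveI : Fact (Nat.Prime 2) := ⟨Nat.prime_two⟩
  have h3 : Module.finrank ℚ ↥(IntermediateField.adjoin ℚ ({β} : Set (AlgebraicClosure ℚ))) = 3 :=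
    AddKatoTwo.finrank_adjoin_root_twoTorsionPolynomial_eq_three W hirr hβ
  have hodd3 : ¬ 2 ∣ Module.finrank ℚ ↥(IntermediateField.adjoin ℚ ({β} : Set (AlgebraicClosure ℚ))) := by rw [h3]; decide
  have hoddK : Odd (Module.finrank ℚ ↥(IntermediateField.adjoin ℚ ({β} : Set (AlgebraicClosure ℚ)))) :=
    Nat.odd_iff.mpr (Nat.two_dvd_ne_zero.mp hodd3)
  have hrank : Units.rank ↥(IntermediateField.adjoin ℚ ({β} : Set (AlgebraicClosure ℚ))) = 1 :=
    units_rank_eq_one_of_nrRealPlaces_eq_one _ h3 (nrRealPlaces_adjoin_root_twoTorsionPolynomial_eq_one W hΔ hirr hβ)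
  have h8 : minimalDiscriminantInt W % 8 ≠ 1 := by rw [h85]; decide
  have hs := (not_onKilfordStratumAtTwo_iff_minimalDiscriminantInt_emod_eight_ne W hord).mpr h8
  have h2 := ncard_eq_two_of_not_onKilfordStratumAtTwo ↥(IntermediateField.adjoin ℚ ({β} : Set (AlgebraicClosure ℚ))) W hord ht h3
    (AlignedTransportAtTwoCubicKilfordPrimes.aeval_four_mul_gen_twoDivisionUCubic W hβ) hs
  obtain ⟨h𝔭₁, hP0, h2P, hcard⟩ := isPrime_and_mem_of_absNorm_eq_two 𝔭₁ hN
  haveI := h𝔭₁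
  haveI : 𝔭₁.IsMaximal := h𝔭₁.isMaximal hP0
  have hres := forall_mem_or_sub_one_mem_of_card_quotient_eq_two 𝔭₁ hcard
  have h2P' : (2 : 𝓞 ↥(IntermediateField.adjoin ℚ ({β} : Set (AlgebraicClosure ℚ)))) ∉ 𝔭₁ ^ 2 := two_not_mem_sq_of_not_dvd_discr hd 𝔭₁ h2P
  have hunits := forall_units_sub_one_mem_or_add_one_mem_of_rank_eq_one hoddK hrank 𝔭₁ hP0 hres h2P h2P' hε hnsq
  exact classicalMuVanishes_two_of_relation_of_genusCert_layer_anyDepth hodd3 hd κP hκP h2 hh (by omega : 1 ≤ j + 2) 𝔭₁ hres h2P hunits hπ hA0 hA σ hσ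
    hcA hd2 hu hF hrel

end Summit.BirchSwinnertonDyer.BirchSwinnertonDyer.Theorems.AlignedTransportAtTwoCubicRelationDoor

end
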